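import Mathlib.Analysis.SpecialFunctions.Sqrt
import Mathlib.Analysis.SpecialFunctions.Pow.Deriv
import Mathlib.Analysis.SpecialFunctions.ExpDeriv
import HarnessLib

/-!
# The radial profile of the drift-robust heat kernels: real-variable calculus

Analysis/FluidPDE support file (pure real-variable layer) for the proof of the named fact
`Literature.Analysis.FluidPDE.KNSS2009_lemma21` (KNSS 2009, Lemma 2.1 as printed). The proof
compares nonnegative solutions of `v_t + a·∇v − Δv = 0`, `‖a‖ ≤ A`, with barriers built from
the two **drift-robust heat kernels**

  `k_ε(σ, y) = (4πσ)^{-n/2} exp(−‖y‖²/(4σ)) · exp(ε (A √(‖y‖² + σ) + 2(n+1)A√σ + 2A²σ))`,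
  `ε = ±1`,

a Gauss–Weierstrass kernel tilted by `e^{±A√(‖y‖²+σ)}`: `k₊` is a supersolution and `k₋` a
subsolution of the heat equation *for every drift* `‖a‖ ≤ A` at once,
`ε (∂_σ k_ε − Δ k_ε) − A ‖∇k_ε‖ ≥ 0` (`σ > 0`), and both are approximate identities as
`σ → 0⁺`. This file is the calculus of the radial profile in the variable `s = ‖y‖²`:

* `dkExp n ε A σ s = −s/(4σ) + ε(A√(s+σ) + 2(n+1)A√σ + 2A²σ)` (the exponent), its first and
  second `s`-derivatives `dkExp₁`, `dkExp₂`, and `dkExpT` = `∂_σ` of the exponent plus the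
  normalisation term `−n/(2σ)`;
* `driftKernelProfile n ε A σ s = (4πσ)^{-n/2} exp(dkExp n ε A σ s)` with its `s`- and
  `σ`-derivatives (`hasDerivAt_driftKernelProfile`, `hasDerivAt_driftKernelProfile₁`,
  `hasDerivAt_driftKernelProfile_sigma`);
* `driftKernel_bracket_nonneg`: the algebraic heart of the sub/supersolution property — with
  `z = ‖y‖`, `s = z²`, `ρ² = s + σ`, `τ² = σ`, `ε = ±1`, `A ≥ 0`, `n ≥ 0`,
  `2A |dkExp₁| z ≤ ε (dkExpT − (4 (dkExp₁² + dkExp₂) s + 2n dkExp₁))`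
  (the right side is `k⁻¹ · ε(∂_σ k − Δk)`, the left side bounds `k⁻¹ · A‖∇k‖`). Indeed the
  right side minus the left side is
  `A/(2ρ) + (n+1)A/τ + 2A² + As/(σρ) − εA²s/ρ² + As/ρ³ − nA/ρ − 2A|dkExp₁|z`, and
  `2A|dkExp₁|z ≤ Az/(2σ) + A²`, `εA²s/ρ² ≤ A²`, `nA/ρ ≤ nA/τ`, `As/(σρ) − Az/(2σ) ≥ −A/(2τ)`
  (if `z < ρ/2` then `z < τ`), leaving `≥ A/(2τ) ≥ 0`.

The kernels on a finite-dimensional inner product space, their Laplacian (radial calculus) and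
the differential inequality are in `DriftHeatKernel`.

## References

* G. Koch, N. Nadirashvili, G. Seregin, V. Šverák, *Liouville theorems for the Navier–Stokes
  equations and applications*, Acta Math. 203 (2009) = arXiv:0709.3599, Lemma 2.1 (p. 5).
  [KochNadirashviliSereginSverak2009]
* G. M. Lieberman, *Second Order Parabolic Differential Equations*, World Scientific (1996),
  Ch. II (comparison with explicit sub/supersolutions). [Lieberman1996]
-/

noncomputable section

open Real Set

namespace Literature.Analysis.FluidPDE

/-! ### The exponent and its derivatives -/

/-- The exponent of the drift-robust heat kernel in the radial variable `s = ‖y‖²`: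
`−s/(4σ) + ε (A√(s+σ) + 2(n+1)A√σ + 2A²σ)`. [folklore] -/
def dkExp (n ε A σ s : ℝ) : ℝ :=
  -s / (4 * σ) + ε * (A * √(s + σ) + 2 * (n + 1) * A * √σ + 2 * A ^ 2 * σ)

/-- First `s`-derivative of `dkExp`: `−1/(4σ) + εA/(2√(s+σ))`. [folklore] -/
def dkExp₁ (ε A σ s : ℝ) : ℝ := -1 / (4 * σ) + ε * A / (2 * √(s + σ))

/-- Second `s`-derivative of `dkExp`: `−εA/(4 (s+σ)^{3/2})`. [folklore] -/
def dkExp₂ (ε A σ s : ℝ) : ℝ := -(ε * A) / (4 * ((s + σ) * √(s + σ)))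

/-- `σ`-derivative of `dkExp` plus the logarithmic `σ`-derivative `−n/(2σ)` of the
normalisation `(4πσ)^{-n/2}`:
`−n/(2σ) + s/(4σ²) + ε (A/(2√(s+σ)) + (n+1)A/√σ + 2A²)`. [folklore] -/
def dkExpT (n ε A σ s : ℝ) : ℝ :=
  -n / (2 * σ) + s / (4 * σ ^ 2) + ε * (A / (2 * √(s + σ)) + (n + 1) * A / √σ + 2 * A ^ 2)

/-- The radial profile `(4πσ)^{-n/2} exp(dkExp n ε A σ s)` of the drift-robust heat kernel.
[folklore] -/
def driftKernelProfile (n ε A σ s : ℝ) : ℝ := (4 * π * σ) ^ (-n / 2) * exp (dkExp n ε A σ s)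

/-- The profile is positive for `σ > 0`. [folklore] -/
theorem driftKernelProfile_pos (n ε A : ℝ) {σ : ℝ} (hσ : 0 < σ) (s : ℝ) :
    0 < driftKernelProfile n ε A σ s := by
  unfold driftKernelProfile
  exact mul_pos (rpow_pos_of_pos (by positivity) _) (exp_pos _)

/-- `∂ₛ dkExp = dkExp₁` where `s + σ > 0`. [folklore] -/
theorem hasDerivAt_dkExp (n ε A σ : ℝ) {s : ℝ} (hs : 0 < s + σ) :
    HasDerivAt (dkExp n ε A σ) (dkExp₁ ε A σ s) s := by
  have h1 : HasDerivAt (fun x : ℝ => -x / (4 * σ)) (-1 / (4 * σ)) s :=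
    ((hasDerivAt_id s).neg).div_const (4 * σ)
  have h2 : HasDerivAt (fun x : ℝ => √(x + σ)) (1 / (2 * √(s + σ))) s :=
    ((hasDerivAt_id s).add_const σ).sqrt hs.ne'
  have h3 : HasDerivAt
      (fun x : ℝ => ε * (A * √(x + σ) + 2 * (n + 1) * A * √σ + 2 * A ^ 2 * σ))
      (ε * (A * (1 / (2 * √(s + σ))))) s :=
    (((h2.const_mul A).add_const _).add_const _).const_mul ε
  have h := h1.add h3
  refine (h.congr_of_eventuallyEq (Filter.Eventually.of_forall fun x => rfl)).congr_deriv ?_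
  rw [dkExp₁]
  ring

/-- `∂ₛ dkExp₁ = dkExp₂` where `s + σ > 0`. [folklore] -/
theorem hasDerivAt_dkExp₁ (ε A σ : ℝ) {s : ℝ} (hs : 0 < s + σ) :
    HasDerivAt (dkExp₁ ε A σ) (dkExp₂ ε A σ s) s := by
  have h2 : HasDerivAt (fun x : ℝ => √(x + σ)) (1 / (2 * √(s + σ))) s :=
    ((hasDerivAt_id s).add_const σ).sqrt hs.ne'
  have hsq : √(s + σ) ≠ 0 := (sqrt_pos.2 hs).ne'
  have h3 : HasDerivAt (fun x : ℝ => (√(x + σ))⁻¹) (-(1 / (2 * √(s + σ))) / (√(s + σ)) ^ 2) s :=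
    h2.inv hsq
  have h4 : HasDerivAt (fun x : ℝ => -1 / (4 * σ) + ε * A / 2 * (√(x + σ))⁻¹)
      (0 + ε * A / 2 * (-(1 / (2 * √(s + σ))) / (√(s + σ)) ^ 2)) s :=
    (hasDerivAt_const s _).add (h3.const_mul _)
  have hfun : dkExp₁ ε A σ = fun x => -1 / (4 * σ) + ε * A / 2 * (√(x + σ))⁻¹ := by
    funext x
    rw [dkExp₁]
    ring
  rw [hfun]
  refine h4.congr_deriv ?_
  rw [dkExp₂, sq_sqrt hs.le]
  field_simp
  ring

/-- `∂ₛ` of the profile: `P' = P · dkExp₁`. [folklore] -/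
theorem hasDerivAt_driftKernelProfile (n ε A : ℝ) {σ s : ℝ} (hs : 0 < s + σ) :
    HasDerivAt (driftKernelProfile n ε A σ)
      (driftKernelProfile n ε A σ s * dkExp₁ ε A σ s) s := by
  have h := ((hasDerivAt_dkExp n ε A σ hs).exp).const_mul ((4 * π * σ) ^ (-n / 2))
  refine h.congr_deriv ?_
  rw [driftKernelProfile]
  ring

/-- `∂ₛ (P · dkExp₁) = P · (dkExp₁² + dkExp₂)`. [folklore] -/
theorem hasDerivAt_driftKernelProfile₁ (n ε A : ℝ) {σ s : ℝ} (hs : 0 < s + σ) :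
    HasDerivAt (fun x => driftKernelProfile n ε A σ x * dkExp₁ ε A σ x)
      (driftKernelProfile n ε A σ s * (dkExp₁ ε A σ s ^ 2 + dkExp₂ ε A σ s)) s := by
  have h := (hasDerivAt_driftKernelProfile n ε A hs).mul (hasDerivAt_dkExp₁ ε A σ hs)
  refine h.congr_deriv ?_
  ring

/-- `∂_σ` of the profile at fixed `s ≥ 0`: `∂_σ P = P · dkExpT`. [folklore] -/
theorem hasDerivAt_driftKernelProfile_sigma (n ε A : ℝ) {σ s : ℝ} (hσ : 0 < σ) (hs : 0 ≤ s) :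
    HasDerivAt (fun σ' => driftKernelProfile n ε A σ' s)
      (driftKernelProfile n ε A σ s * dkExpT n ε A σ s) σ := by
  have hsσ : 0 < s + σ := by linarith
  have h4π : (0 : ℝ) < 4 * π * σ := by positivity
  -- the normalisation
  have hN : HasDerivAt (fun σ' : ℝ => (4 * π * σ') ^ (-n / 2))
      ((4 * π * σ) ^ (-n / 2) * (-n / (2 * σ))) σ := by
    have h1 : HasDerivAt (fun σ' : ℝ => 4 * π * σ') (4 * π) σ := by
      simpa using (hasDerivAt_id σ).const_mul (4 * π)
    have h2 := h1.rpow_const (p := -n / 2) (Or.inl h4π.ne')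
    refine h2.congr_deriv ?_
    rw [rpow_sub_one h4π.ne']
    field_simp
  -- the exponent
  have hE : HasDerivAt (fun σ' : ℝ => dkExp n ε A σ' s)
      (s / (4 * σ ^ 2) + ε * (A / (2 * √(s + σ)) + (n + 1) * A / √σ + 2 * A ^ 2)) σ := by
    have e1 : HasDerivAt (fun σ' : ℝ => -s / 4 * σ'⁻¹) (-s / 4 * (-(σ ^ 2)⁻¹)) σ :=
      (hasDerivAt_inv hσ.ne').const_mul _
    have e2 : HasDerivAt (fun σ' : ℝ => √(s + σ')) (1 / (2 * √(s + σ))) σ :=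
      ((hasDerivAt_id σ).const_add s).sqrt hsσ.ne'
    have e3 : HasDerivAt (fun σ' : ℝ => √σ') (1 / (2 * √σ)) σ := hasDerivAt_sqrt hσ.ne'
    have e4 : HasDerivAt (fun σ' : ℝ => 2 * A ^ 2 * σ') (2 * A ^ 2) σ := by
      simpa using (hasDerivAt_id σ).const_mul (2 * A ^ 2)
    have e5 : HasDerivAt
        (fun σ' : ℝ => ε * (A * √(s + σ') + 2 * (n + 1) * A * √σ' + 2 * A ^ 2 * σ'))
        (ε * (A * (1 / (2 * √(s + σ))) + 2 * (n + 1) * A * (1 / (2 * √σ)) + 2 * A ^ 2)) σ :=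
      (((e2.const_mul A).add (e3.const_mul _)).add e4).const_mul ε
    have hfun : (fun σ' : ℝ => dkExp n ε A σ' s) = fun σ' =>
        -s / 4 * σ'⁻¹ + ε * (A * √(s + σ') + 2 * (n + 1) * A * √σ' + 2 * A ^ 2 * σ') := by
      funext σ'
      rw [dkExp]
      ring
    rw [hfun]
    refine (e1.add e5).congr_deriv ?_
    field_simp
  have h := hN.mul hE.exp
  refine h.congr_deriv ?_
  simp only [driftKernelProfile, dkExpT]
  ring

/-! ### The algebraic heart of the sub/supersolution property -/

/-- Bound for the logarithmic gradient factor: `|dkExp₁| ≤ 1/(4σ) + A/(2√(s+σ))` for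
`ε = ±1`, `A ≥ 0`, `σ > 0`. [folklore] -/
theorem abs_dkExp₁_le {ε A σ s : ℝ} (hε : ε = 1 ∨ ε = -1) (hA : 0 ≤ A) (hσ : 0 < σ)
    (hs : 0 < s + σ) : |dkExp₁ ε A σ s| ≤ 1 / (4 * σ) + A / (2 * √(s + σ)) := by
  have hρ : 0 < √(s + σ) := sqrt_pos.2 hs
  have h1 : 0 ≤ 1 / (4 * σ) := by positivity
  have h2 : 0 ≤ A / (2 * √(s + σ)) := by positivity
  have h3 : |ε * A / (2 * √(s + σ))| = A / (2 * √(s + σ)) := by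
    rcases hε with rfl | rfl
    · rw [one_mul, abs_of_nonneg h2]
    · rw [neg_one_mul, neg_div, abs_neg, abs_of_nonneg h2]
  rw [dkExp₁]
  calc |-1 / (4 * σ) + ε * A / (2 * √(s + σ))|
      ≤ |-1 / (4 * σ)| + |ε * A / (2 * √(s + σ))| := abs_add_le _ _
    _ = 1 / (4 * σ) + A / (2 * √(s + σ)) := by
        rw [h3, neg_div, abs_neg, abs_of_nonneg h1]

/-- **The algebraic heart of the sub/supersolution property of the drift-robust heat kernels.**
With `z = ‖y‖ ≥ 0`, `s = z²`, `ε = ±1`, `A ≥ 0`, `n ≥ 0`, `σ > 0`: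
`2A |dkExp₁| z ≤ ε (dkExpT − (4 (dkExp₁² + dkExp₂) z² + 2n dkExp₁))`; multiplied by the
(positive) kernel this is `A‖∇k‖ ≤ ε(∂_σ k − Δk)`. See the module docstring for the
estimate. [folklore] -/
theorem driftKernel_bracket_nonneg {n ε A σ z : ℝ} (hε : ε = 1 ∨ ε = -1) (hn : 0 ≤ n)
    (hA : 0 ≤ A) (hσ : 0 < σ) (hz : 0 ≤ z) :
    2 * A * |dkExp₁ ε A σ (z ^ 2)| * z ≤
      ε * (dkExpT n ε A σ (z ^ 2) -
        (4 * (dkExp₁ ε A σ (z ^ 2) ^ 2 + dkExp₂ ε A σ (z ^ 2)) * z ^ 2 +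
          2 * n * dkExp₁ ε A σ (z ^ 2))) := by
  have hs : 0 < z ^ 2 + σ := by positivity
  have habs := abs_dkExp₁_le (s := z ^ 2) hε hA hσ hs
  set ρ : ℝ := √(z ^ 2 + σ) with hρdef
  set τ : ℝ := √σ with hτdef
  have hρpos : 0 < ρ := sqrt_pos.2 hs
  have hτpos : 0 < τ := sqrt_pos.2 hσ
  have hρ2 : ρ ^ 2 = z ^ 2 + σ := sq_sqrt hs.le
  have hτ2 : τ ^ 2 = σ := sq_sqrt hσ.le
  have hzρ : z ≤ ρ := by
    rw [hρdef]
    calc z = √(z ^ 2) := (sqrt_sq hz).symm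
      _ ≤ √(z ^ 2 + σ) := sqrt_le_sqrt (by linarith)
  have hτρ : τ ≤ ρ := by
    rw [hρdef, hτdef]
    exact sqrt_le_sqrt (by nlinarith)
  -- the identity `ε (dkExpT − (4(F₁² + F₂) z² + 2n F₁)) = …` (uses `ε² = 1`)
  have hI : ε * (dkExpT n ε A σ (z ^ 2) -
        (4 * (dkExp₁ ε A σ (z ^ 2) ^ 2 + dkExp₂ ε A σ (z ^ 2)) * z ^ 2 +
          2 * n * dkExp₁ ε A σ (z ^ 2))) =
      A / (2 * ρ) + (n + 1) * A / τ + 2 * A ^ 2 + A * z ^ 2 / (σ * ρ) -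
        ε * A ^ 2 * z ^ 2 / ρ ^ 2 + A * z ^ 2 / (ρ ^ 2 * ρ) - n * A / ρ := by
    simp only [dkExpT, dkExp₁, dkExp₂]
    rw [← hρdef, ← hτdef, ← hρ2]
    rcases hε with rfl | rfl
    · field_simp
      ring
    · field_simp
      ring
  -- the left side
  have hL : 2 * A * |dkExp₁ ε A σ (z ^ 2)| * z ≤ A * z / (2 * σ) + A ^ 2 * z / ρ := by
    have h1 : 2 * A * |dkExp₁ ε A σ (z ^ 2)| * z ≤ 2 * A * (1 / (4 * σ) + A / (2 * ρ)) * z :=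
      mul_le_mul_of_nonneg_right (mul_le_mul_of_nonneg_left habs (by positivity)) hz
    have h2 : 2 * A * (1 / (4 * σ) + A / (2 * ρ)) * z = A * z / (2 * σ) + A ^ 2 * z / ρ := by
      field_simp
      ring
    linarith
  have h2 : A ^ 2 * z / ρ ≤ A ^ 2 := by
    rw [div_le_iff₀ hρpos]
    exact mul_le_mul_of_nonneg_left hzρ (by positivity)
  -- `A z²/(σρ) − A z/(2σ) ≥ −A/(2τ)`
  have h3 : -(A / (2 * τ)) ≤ A * z ^ 2 / (σ * ρ) - A * z / (2 * σ) := by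
    rcases le_or_gt (ρ / 2) z with hcase | hcase
    · -- `z ≥ ρ/2`: the difference is nonnegative
      have e1 : A * z / (2 * σ) ≤ A * z ^ 2 / (σ * ρ) := by
        rw [div_le_div_iff₀ (by positivity) (by positivity)]
        have : A * z * (σ * ρ) ≤ A * z * (σ * (2 * z)) :=
          mul_le_mul_of_nonneg_left (mul_le_mul_of_nonneg_left (by linarith) hσ.le)
            (by positivity)
        nlinarith
      have e2 : 0 ≤ A / (2 * τ) := by positivity
      linarith
    · -- `z < ρ/2`: then `z ≤ τ`
      have hzτ : z ≤ τ := by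
        have h4 : 4 * z ^ 2 < ρ ^ 2 := by nlinarith
        rw [hρ2] at h4
        have h5 : z ^ 2 ≤ τ ^ 2 := by rw [hτ2]; nlinarith
        exact (pow_le_pow_iff_left₀ hz hτpos.le two_ne_zero).1 h5
      have e3 : 0 ≤ A * z ^ 2 / (σ * ρ) := by positivity
      have e4 : A * z / (2 * σ) ≤ A / (2 * τ) := by
        rw [div_le_div_iff₀ (by positivity) (by positivity), ← hτ2]
        have : 0 ≤ 2 * A * τ * (τ - z) := mul_nonneg (by positivity) (by linarith)
        nlinarith
      linarith
  have h4 : ε * A ^ 2 * z ^ 2 / ρ ^ 2 ≤ A ^ 2 := by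
    have hz2 : z ^ 2 ≤ ρ ^ 2 := pow_le_pow_left₀ hz hzρ 2
    rcases hε with rfl | rfl
    · rw [one_mul, div_le_iff₀ (by positivity)]
      exact mul_le_mul_of_nonneg_left hz2 (by positivity)
    · have : 0 ≤ A ^ 2 * z ^ 2 / ρ ^ 2 := by positivity
      have h' : -1 * A ^ 2 * z ^ 2 / ρ ^ 2 = -(A ^ 2 * z ^ 2 / ρ ^ 2) := by ring
      rw [h']
      nlinarith
  have h5 : n * A / ρ ≤ n * A / τ := div_le_div_of_nonneg_left (by positivity) hτpos hτρ
  have h6 : 0 ≤ A / (2 * ρ) := by positivity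
  have h7 : 0 ≤ A * z ^ 2 / (ρ ^ 2 * ρ) := by positivity
  have hsplit : (n + 1) * A / τ = n * A / τ + A / τ := by ring
  have hhalf : A / (2 * τ) ≤ A / τ := div_le_div_of_nonneg_left hA hτpos (by linarith)
  have hAτ : 0 ≤ A / (2 * τ) := by positivity
  rw [hI]
  linarith

end Literature.Analysis.FluidPDE

end
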